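import Mathlib
import Literature.Analysis.OperatorTheory.PseudospectraEquivalentDefinitions
import Literature.Analysis.OperatorTheory.PseudospectraNormalBauerFike
import Literature.Analysis.OperatorTheory.StabilityRadius

/-!
# The certified Floquet box `(P⁺)_F`: logical skeleton (solo-blind s79, paper §24.88–24.89)

On a re-designed carrier (regime (α) of the leaf-Floquet trichotomy) the pattern-scale block of the
steady linearisation is inverted leaf by leaf through `(1 − M)⁻¹`, `M` = the monodromy of the
Kelvin-mode chain over one leaf period.  What the solvability hierarchy `(E₆)` consumes is an
`n`-free bound `‖(1 − M(p))⁻¹‖ ≤ K` uniformly over the parameter box `p = (P, k, c)`.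

The numerics certify, for finitely many REFERENCE matrices `N` (finite truncation `J`, finite time
step), that `σ(N) ⊂ {|z| < r}` with `r = e^{-δ/2} < 1` and that the resolvent norm is `≤ C` on the
circle `|w| = r`.  The TRUE monodromies differ from `N` by `‖M(p) − N‖ ≤ η` (J-tail + time
discretisation + parameter modulus on the sub-box + the `(K3)` dressing of the pattern profile).
This file proves, in an arbitrary complex Banach algebra, that `η·C < 1` transports BOTH the
spectral enclosure AND a resolvent-norm bound `C/(1 − ηC)` to every `M(p)`, in particular
`‖(1 − M(p))⁻¹‖ ≤ C/(1 − ηC)` — the constant `(E₆)` uses.  The analytic inputs (maximum principle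
outside a disk, Neumann series, stability radius) are the Literature facts cited by name.
-/

open Metric

namespace Summit.AnomalousDissipation.AnomalousDissipation.Theorems

open Literature.Analysis.OperatorTheory.Pseudospectra
open Literature.Analysis.OperatorTheory.StabilityRadius

variable {A : Type*} [NormedRing A] [NormedAlgebra ℂ A] [NormOneClass A] [CompleteSpace A]

/-- Elementary monotonicity used to pass from `‖u⁻¹‖ ≤ C`, `‖e‖ ≤ η` to the bound `C/(1 − ηC)`:
`x/(1 − a x) ≤ C/(1 − η C)` for `0 ≤ x ≤ C`, `0 ≤ a ≤ η`, `η C < 1`. -/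
theorem div_one_sub_mul_mono {x a C η : ℝ} (hx : 0 ≤ x) (hxC : x ≤ C) (ha : 0 ≤ a) (haη : a ≤ η)
    (hηC : η * C < 1) : x / (1 - a * x) ≤ C / (1 - η * C) := by
  have hC : 0 ≤ C := hx.trans hxC
  have hax : a * x ≤ η * C := mul_le_mul haη hxC hx (ha.trans haη)
  have hpos : 0 < 1 - η * C := sub_pos.mpr hηC
  have hle : 1 - η * C ≤ 1 - a * x := by linarith
  calc x / (1 - a * x) ≤ x / (1 - η * C) := div_le_div_of_nonneg_left hx hpos hle
    _ ≤ C / (1 - η * C) := div_le_div_of_nonneg_right hxC hpos.le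

/-- **Perturbed resolvent outside the certified disk.**  If `σ(N) ⊂ {|z| < r}`, the resolvent norm
of `N` is `≤ C` on the circle `|w| = r`, and `‖e‖·C < 1`, then every `z` with `|z| ≥ r` is in the
resolvent set of `N + e` and `‖(z − (N + e))⁻¹‖ ≤ C/(1 − ‖e‖ C)`.
(Maximum principle outside the disk for `N` [StabilityRadius.norm_resolvent_le_of_forall_sphere_le],
then the Neumann-series bound [Pseudospectra.norm_inverse_add_le].) -/
theorem resolvent_add_bound_of_sphere {N e : A} {r C : ℝ} (hr : 0 < r)
    (hN : spectrum ℂ N ⊆ ball (0 : ℂ) r) (hC : ∀ w : ℂ, ‖w‖ = r → ‖resolvent N w‖ ≤ C)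
    (he : ‖e‖ * C < 1) {z : ℂ} (hz : r ≤ ‖z‖) :
    z ∈ resolventSet ℂ (N + e) ∧ ‖resolvent (N + e) z‖ ≤ C / (1 - ‖e‖ * C) := by
  have hρ : z ∈ resolventSet ℂ N :=
    mem_resolventSet_of_notMem hN (by simpa [Metric.mem_ball, dist_zero_right] using hz)
  have hRz : ‖resolvent N z‖ ≤ C := norm_resolvent_le_of_forall_sphere_le hr hN hC hz
  rw [spectrum.mem_resolventSet_iff] at hρ
  obtain ⟨u, hu⟩ := hρ
  have hres : resolvent N z = (↑u⁻¹ : A) := resolvent_eq_units_inv hu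
  have hu_le : ‖(↑u⁻¹ : A)‖ ≤ C := hres ▸ hRz
  have hlt : ‖-e‖ * ‖(↑u⁻¹ : A)‖ < 1 := by
    rw [norm_neg]
    calc ‖e‖ * ‖(↑u⁻¹ : A)‖ ≤ ‖e‖ * C := mul_le_mul_of_nonneg_left hu_le (norm_nonneg _)
      _ < 1 := he
  obtain ⟨hunit, hbound⟩ := norm_inverse_add_le u (-e) hlt
  have heq : (u : A) + -e = algebraMap ℂ A z - (N + e) := by rw [hu]; abel
  refine ⟨?_, ?_⟩
  · rw [spectrum.mem_resolventSet_iff, ← heq]; exact hunit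
  · have h1 : resolvent (N + e) z = Ring.inverse ((u : A) + -e) := by rw [resolvent, heq]
    rw [h1]
    refine hbound.trans ?_
    rw [norm_neg]
    exact div_one_sub_mul_mono (norm_nonneg _) hu_le (norm_nonneg _) le_rfl he

/-- **The certified Floquet box, family form.**  A reference `N` certified on the circle `|w| = r`
(`σ(N) ⊂ {|z| < r}`, resolvent norm `≤ C` there) controls every member `M i` of a family with
`‖M i − N‖ ≤ η`, provided `η C < 1`: each `M i` has its spectrum in `{|z| < r}` (all Floquet
multipliers `< r` in modulus) and resolvent norm `≤ C/(1 − ηC)` at every `|z| ≥ r`.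
[spectral half: StabilityRadius.spectrum_add_subset_ball_of_norm_mul_lt_one] -/
theorem floquet_box {ι : Type*} (M : ι → A) (N : A) {r C η : ℝ} (hr : 0 < r)
    (hN : spectrum ℂ N ⊆ ball (0 : ℂ) r) (hC : ∀ w : ℂ, ‖w‖ = r → ‖resolvent N w‖ ≤ C)
    (hM : ∀ i, ‖M i - N‖ ≤ η) (hη : η * C < 1) (i : ι) :
    spectrum ℂ (M i) ⊆ ball (0 : ℂ) r ∧
      ∀ z : ℂ, r ≤ ‖z‖ → z ∈ resolventSet ℂ (M i) ∧ ‖resolvent (M i) z‖ ≤ C / (1 - η * C) := by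
  have hC0 : 0 ≤ C := (norm_nonneg _).trans (hC r (by simp [Complex.norm_real, abs_of_pos hr]))
  have hsplit : M i = N + (M i - N) := by abel
  have he : ‖M i - N‖ * C < 1 :=
    lt_of_le_of_lt (mul_le_mul_of_nonneg_right (hM i) hC0) hη
  refine ⟨?_, fun z hz => ?_⟩
  · rw [hsplit]; exact spectrum_add_subset_ball_of_norm_mul_lt_one hr hN hC he
  · obtain ⟨hρ, hb⟩ := resolvent_add_bound_of_sphere hr hN hC he hz
    refine ⟨hsplit ▸ hρ, ?_⟩
    rw [hsplit]
    refine hb.trans ?_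
    -- monotone in the perturbation size: the elementary lemma with x = C
    calc C / (1 - ‖M i - N‖ * C) ≤ C / (1 - η * C) :=
          div_one_sub_mul_mono hC0 le_rfl (norm_nonneg _) (hM i) hη

/-- **What `(E₆)` consumes.**  Under the hypotheses of `floquet_box` with `r ≤ 1` (e.g.
`r = e^{-δ/2}`, `δ > 0`), `1 − M i` is invertible for every member and
`‖(1 − M i)⁻¹‖ ≤ C/(1 − ηC)` — an `i`-free (in the application: `n`-, leaf- and
wavenumber-free) constant. -/
theorem floquet_box_one_sub_inverse {ι : Type*} (M : ι → A) (N : A) {r C η : ℝ} (hr : 0 < r)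
    (hr1 : r ≤ 1) (hN : spectrum ℂ N ⊆ ball (0 : ℂ) r)
    (hC : ∀ w : ℂ, ‖w‖ = r → ‖resolvent N w‖ ≤ C) (hM : ∀ i, ‖M i - N‖ ≤ η) (hη : η * C < 1)
    (i : ι) : IsUnit (1 - M i) ∧ ‖Ring.inverse (1 - M i)‖ ≤ C / (1 - η * C) := by
  obtain ⟨-, hz⟩ := floquet_box M N hr hN hC hM hη i
  obtain ⟨hρ, hb⟩ := hz 1 (by simpa using hr1)
  have h1 : algebraMap ℂ A 1 - M i = 1 - M i := by rw [map_one]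
  refine ⟨?_, ?_⟩
  · have := spectrum.mem_resolventSet_iff.mp hρ; rwa [h1] at this
  · rwa [resolvent, h1] at hb

/-- The radius used in the application: `r = exp(−δ/2)` with margin `δ > 0` satisfies
`0 < r ≤ 1`, and `|μ| < r ↔ log|μ| < −δ/2` for `μ ≠ 0`. -/
theorem margin_radius {δ : ℝ} (hδ : 0 < δ) :
    0 < Real.exp (-δ / 2) ∧ Real.exp (-δ / 2) ≤ 1 ∧
      ∀ μ : ℂ, μ ≠ 0 → (‖μ‖ < Real.exp (-δ / 2) ↔ Real.log ‖μ‖ < -δ / 2) := by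
  refine ⟨Real.exp_pos _, by rw [Real.exp_le_one_iff]; linarith, fun μ hμ => ?_⟩
  have hpos : 0 < ‖μ‖ := norm_pos_iff.mpr hμ
  rw [← Real.log_lt_log_iff hpos (Real.exp_pos _), Real.log_exp]

/-- **Finite cover form** (how the box is actually certified: a finite list of reference matrices,
each responsible for a sub-box).  If every parameter `i` lies in the sub-box of some certified
reference `N s` (`‖M i − N s‖ ≤ η s`, `σ(N s) ⊂ {|z|<r}`, resolvent `≤ C s` on `|w| = r`,
`η s · C s < 1`), then uniformly `‖(1 − M i)⁻¹‖ ≤ K := max_s C s/(1 − η s C s)`. -/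
theorem floquet_box_cover {ι σ : Type*} [Fintype σ] [Nonempty σ] (M : ι → A) (N : σ → A)
    (C η : σ → ℝ) {r : ℝ} (hr : 0 < r) (hr1 : r ≤ 1)
    (hN : ∀ s, spectrum ℂ (N s) ⊆ ball (0 : ℂ) r)
    (hC : ∀ s, ∀ w : ℂ, ‖w‖ = r → ‖resolvent (N s) w‖ ≤ C s) (hη : ∀ s, η s * C s < 1)
    (cover : ∀ i, ∃ s, ‖M i - N s‖ ≤ η s) (i : ι) :
    IsUnit (1 - M i) ∧
      ‖Ring.inverse (1 - M i)‖ ≤ Finset.univ.sup' Finset.univ_nonempty (fun s => C s / (1 - η s * C s)) := by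
  obtain ⟨s, hs⟩ := cover i
  obtain ⟨hu, hb⟩ := floquet_box_one_sub_inverse (fun _ : Unit => M i) (N s) hr hr1 (hN s) (hC s)
    (fun _ => hs) (hη s) ()
  exact ⟨hu, hb.trans (Finset.le_sup' (fun s => C s / (1 - η s * C s)) (Finset.mem_univ s))⟩

end Summit.AnomalousDissipation.AnomalousDissipation.Theorems
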